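import Literature.AnabelianGeometry.SemiGraphs.TemperedThm37OfNoCore
import Literature.AnabelianGeometry.SemiGraphs.TemperedEdgeLikeDistinctOfLocallyFinite
import HarnessLib

/-!
# [SemiAnbd] Thm 3.7: edge-like subgroups of distinct edges meet trivially — at EVERY graph WITHOUT CORE,
# unconditionally (F-1699 `EdgeLikeDistinct`, instance form beyond local finiteness)

Mochizuki, *Semi-graphs of anabelioids*, Publ. RIMS **42** (2006), §3, Theorem 3.7 (ii)–(iv), manuscript
pp. 40–41 [cite: MochizukiSemiAnbd2006, Thm 3.7(iv) p.41], as used silently in the proof of Cor. 3.9 p. 42 («by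
considering nontrivial intersections of maximal compact subgroups, one obtains … a map from the edges [of] `G` to
the edges of `H`»): edge-like subgroups of DISTINCT edges have trivial intersection, hence infinite mutual index.

PROOF-ONLY (cell abc-iut, block F, seat abc-iut-f-176 gen 4; no definition, no named fact, no custody file touched).
abc-iut-L3-d4's `TemperedEdgeLikeDistinctOfLocallyFinite.lean` (abc-iut-w4-d075's proof with the second conjunct of
Thm 3.7 (iii) supplied by abc-iut-w6-d062's `compactInTwoVerticial_of_isLocallyFinite`) VERBATIM, with that one
input now `compactInTwoVerticial_of_noCore` (`TemperedThm37OfNoCore.lean`, resting on (FIX∞).hadj at graphs without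
an infinitely-branching core, `TemperedHbddOfNoCore.lean`).  So, at every countable Thm-3.7 graph in which every
non-empty set of vertices has a member with finitely many branches toward the set (locally finite, TAME, every star
of any valence, …) and every chart:

* `edgeLike_inf_edgeLike_eq_bot_of_noCore` — `L₁ ⊓ L₂ = ⊥` for edge-like `L₁`, `L₂` of edges `e₁ ≠ e₂`;
* `relIndex_edgeLike_eq_zero_of_noCore` — `L₂.relIndex L₁ = 0`;
* **`edgeLikeDistinctAt_of_noCore : EdgeLikeDistinctAt 𝒢`** — the instance form of F-1699, unconditional at the
  NoCore class (⊋ locally finite: vertices of infinite valence allowed).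

Nothing here bears on [IUTchIII] Cor. 3.12; no side taken; typed ≠ proved.
-/

namespace Literature.AnabelianGeometry.SemiGraphs

namespace ProfiniteSemiGraph

open Topology

universe u

variable {𝒢 : ProfiniteSemiGraph.{u}}

/-- **Edge-like subgroups of distinct edges meet trivially, at every Thm-3.7 graph without core** (every chart):
abc-iut-w4-d075's `edgeLike_inf_edgeLike_eq_bot_at` verbatim, with the second conjunct of Thm 3.7 (iii) supplied by
`compactInTwoVerticial_of_noCore` instead of the hypothesis `CompactInVerticialAt 𝒢`.
[cite: MochizukiSemiAnbd2006, Thm 3.7(iv) p.41] -/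
theorem edgeLike_inf_edgeLike_eq_bot_of_noCore (h𝒢 : 𝒢.Thm37Hypotheses)
    (hNC : ∀ S : Set 𝒢.graph.Vertex, S.Nonempty → ∃ w ∈ S,
      {b : 𝒢.graph.Branch | 𝒢.graph.abuts b = some w ∧ ∃ b', b' ≠ b ∧ 𝒢.graph.edgeOf b' = 𝒢.graph.edgeOf b ∧
        ∃ w' ∈ S, 𝒢.graph.abuts b' = some w'}.Finite) (c : TemperedPiChart 𝒢)
    {e₁ e₂ : 𝒢.graph.Edge} (hne : e₁ ≠ e₂) {L₁ L₂ : Subgroup c.G} (hL₁ : L₁ ∈ edgeLikeSubgroups c e₁)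
    (hL₂ : L₂ ∈ edgeLikeSubgroups c e₂) : L₁ ⊓ L₂ = ⊥ := by
  classical
  have hVD : VerticialDistinct.{u} := verticialDistinct_holds
  have hVI : VerticialInjective.{u} := verticialInjective_holds
  haveI := TemperedPiChart.t2Space c
  -- one verticial homomorphism per vertex
  have hΦ' : ∀ v : 𝒢.graph.Vertex, ∃ φ : 𝒢.Gv v →ₜ* c.G, IsVerticialHom c v φ := by
    intro v
    obtain ⟨H, φ, hφ, -⟩ := (hVI 𝒢 h𝒢 c v).1
    exact ⟨φ, hφ⟩
  choose Φ hΦ using hΦ'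
  -- attached branches of `e₁`, `e₂`
  obtain ⟨w⟩ := h𝒢.hasVertex
  obtain ⟨b₁, hbe₁, hs₁⟩ := SemiGraph.exists_abuts_of_isConnected h𝒢.isConnected w e₁
  obtain ⟨b₂, hbe₂, hs₂⟩ := SemiGraph.exists_abuts_of_isConnected h𝒢.isConnected w e₂
  obtain ⟨v₁, hb₁⟩ := Option.isSome_iff_exists.mp hs₁
  obtain ⟨v₂, hb₂⟩ := Option.isSome_iff_exists.mp hs₂
  subst hbe₁ hbe₂
  have hb₁₂ : b₁ ≠ b₂ := fun h => hne (by rw [h])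
  obtain ⟨g₁, hL₁eq⟩ := edgeLike_eq_map_branchSubgroup c hb₁ hL₁ (Φ v₁) (hΦ v₁)
  obtain ⟨g₂, hL₂eq⟩ := edgeLike_eq_map_branchSubgroup c hb₂ hL₂ (Φ v₂) (hΦ v₂)
  -- the hosts
  set H₁ := (Φ v₁).toMonoidHom.range.map (MulAut.conj g₁).toMonoidHom with hH₁def
  set H₂ := (Φ v₂).toMonoidHom.range.map (MulAut.conj g₂).toMonoidHom with hH₂def
  have hH₁ : H₁ ∈ verticialSubgroups c v₁ :=
    conj_mem_verticialSubgroups c (range_mem_verticialSubgroups c (Φ v₁) (hΦ v₁)) g₁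
  have hH₂ : H₂ ∈ verticialSubgroups c v₂ :=
    conj_mem_verticialSubgroups c (range_mem_verticialSubgroups c (Φ v₂) (hΦ v₂)) g₂
  have hL₁H₁ : L₁ ≤ H₁ := by rw [hL₁eq]; exact Subgroup.map_mono (Subgroup.map_le_range _ _)
  have hL₂H₂ : L₂ ≤ H₂ := by rw [hL₂eq]; exact Subgroup.map_mono (Subgroup.map_le_range _ _)
  by_contra hK
  -- Case I: equal hosts
  by_cases hH12 : H₁ = H₂
  · exact hb₁₂ (branch_eq_of_hosts_eq hVD hVI h𝒢 c Φ hΦ hK hb₁ hb₂ g₁ g₂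
      (by rw [← hL₁eq]; exact inf_le_left) (by rw [← hL₂eq]; exact inf_le_right) hH12)
  -- Case II: distinct hosts; `K = L₁ ⊓ L₂` is compact and nontrivial
  have hKc : IsCompact ((L₁ ⊓ L₂ : Subgroup c.G) : Set c.G) := by
    rw [Subgroup.coe_inf]
    exact (isCompact_of_mem_edgeLikeSubgroups c hL₁).inter_right
      (isCompact_of_mem_edgeLikeSubgroups c hL₂).isClosed
  -- the second conjunct of Thm 3.7 (iii), UNCONDITIONAL at graphs without core (`TemperedThm37OfNoCore.lean`)
  obtain ⟨honly, e, L, he, hL, hKL⟩ := 𝒢.compactInTwoVerticial_of_noCore h𝒢 hNC c (L₁ ⊓ L₂) hKc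
    hK hH₁ hH₂ hH12 (inf_le_left.trans hL₁H₁) (inf_le_right.trans hL₂H₂)
  obtain ⟨b, b', u, u', hbb', hbe, hb'e, hb, hb'⟩ := SemiGraph.exists_branches_of_isClosedEdge he
  subst hbe
  obtain ⟨g, hLeq⟩ := edgeLike_eq_map_branchSubgroup c hb hL (Φ u) (hΦ u)
  have hL' : L ∈ edgeLikeSubgroups c (𝒢.graph.edgeOf b') := by rw [hb'e]; exact hL
  obtain ⟨g', hLeq'⟩ := edgeLike_eq_map_branchSubgroup c hb' hL' (Φ u') (hΦ u')
  set H := (Φ u).toMonoidHom.range.map (MulAut.conj g).toMonoidHom with hHdef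
  set H' := (Φ u').toMonoidHom.range.map (MulAut.conj g').toMonoidHom with hH'def
  have hHm : H ∈ verticialSubgroups c u :=
    conj_mem_verticialSubgroups c (range_mem_verticialSubgroups c (Φ u) (hΦ u)) g
  have hH'm : H' ∈ verticialSubgroups c u' :=
    conj_mem_verticialSubgroups c (range_mem_verticialSubgroups c (Φ u') (hΦ u')) g'
  have hKH : L₁ ⊓ L₂ ≤ H := hKL.trans (by rw [hLeq]; exact Subgroup.map_mono (Subgroup.map_le_range _ _))
  have hKH' : L₁ ⊓ L₂ ≤ H' :=
    hKL.trans (by rw [hLeq']; exact Subgroup.map_mono (Subgroup.map_le_range _ _))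
  -- membership data for `branch_eq_of_hosts_eq`
  have hKLb : L₁ ⊓ L₂ ≤ ((𝒢.branchSubgroup b u hb).map (Φ u).toMonoidHom).map (MulAut.conj g).toMonoidHom := by
    rw [← hLeq]; exact hKL
  have hKLb' : L₁ ⊓ L₂ ≤
      ((𝒢.branchSubgroup b' u' hb').map (Φ u').toMonoidHom).map (MulAut.conj g').toMonoidHom := by
    rw [← hLeq']; exact hKL
  have hKL₁ : L₁ ⊓ L₂ ≤
      ((𝒢.branchSubgroup b₁ v₁ hb₁).map (Φ v₁).toMonoidHom).map (MulAut.conj g₁).toMonoidHom := by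
    rw [← hL₁eq]; exact inf_le_left
  have hKL₂ : L₁ ⊓ L₂ ≤
      ((𝒢.branchSubgroup b₂ v₂ hb₂).map (Φ v₂).toMonoidHom).map (MulAut.conj g₂).toMonoidHom := by
    rw [← hL₂eq]; exact inf_le_right
  -- the two hosts of `L` are among `H₁`, `H₂`
  rcases honly u H hHm hKH with hH1 | hH2 <;> rcases honly u' H' hH'm hKH' with hH'1 | hH'2
  · -- H = H₁ = H' : the two branches of `e` inside one host
    exact hbb' (branch_eq_of_hosts_eq hVD hVI h𝒢 c Φ hΦ hK hb hb' g g' hKLb hKLb' (hH1.trans hH'1.symm))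
  · -- H = H₁, H' = H₂ : `b = b₁`, `b' = b₂`, so `e₁ = e = e₂`
    have h1 := branch_eq_of_hosts_eq hVD hVI h𝒢 c Φ hΦ hK hb hb₁ g g₁ hKLb hKL₁ hH1
    have h2 := branch_eq_of_hosts_eq hVD hVI h𝒢 c Φ hΦ hK hb' hb₂ g' g₂ hKLb' hKL₂ hH'2
    subst h1 h2
    exact hne hb'e.symm
  · -- H = H₂, H' = H₁
    have h1 := branch_eq_of_hosts_eq hVD hVI h𝒢 c Φ hΦ hK hb hb₂ g g₂ hKLb hKL₂ hH2
    have h2 := branch_eq_of_hosts_eq hVD hVI h𝒢 c Φ hΦ hK hb' hb₁ g' g₁ hKLb' hKL₁ hH'1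
    subst h1 h2
    exact hne hb'e
  · -- H = H₂ = H'
    exact hbb' (branch_eq_of_hosts_eq hVD hVI h𝒢 c Φ hΦ hK hb hb' g g' hKLb hKLb' (hH2.trans hH'2.symm))

/-- **`EdgeLikeDistinct`, unfolded, at every Thm-3.7 graph without core**: for distinct edges `e₁ ≠ e₂` and
edge-like `L₁`, `L₂`, `L₂.relIndex L₁ = 0` (trivial intersection, `L₁` infinite by abc-iut-w4-d075's
`infinite_of_mem_edgeLikeSubgroups`). [cite: MochizukiSemiAnbd2006, Thm 3.7(iv) p.41] -/
theorem relIndex_edgeLike_eq_zero_of_noCore (h𝒢 : 𝒢.Thm37Hypotheses)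
    (hNC : ∀ S : Set 𝒢.graph.Vertex, S.Nonempty → ∃ w ∈ S,
      {b : 𝒢.graph.Branch | 𝒢.graph.abuts b = some w ∧ ∃ b', b' ≠ b ∧ 𝒢.graph.edgeOf b' = 𝒢.graph.edgeOf b ∧
        ∃ w' ∈ S, 𝒢.graph.abuts b' = some w'}.Finite)
    (c : TemperedPiChart 𝒢) {e₁ e₂ : 𝒢.graph.Edge} (hne : e₁ ≠ e₂) {L₁ L₂ : Subgroup c.G}
    (hL₁ : L₁ ∈ edgeLikeSubgroups c e₁) (hL₂ : L₂ ∈ edgeLikeSubgroups c e₂) : L₂.relIndex L₁ = 0 := by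
  haveI := infinite_of_mem_edgeLikeSubgroups verticialInjective_holds h𝒢 c hL₁
  have hbot : L₂ ⊓ L₁ = ⊥ := by
    rw [inf_comm]; exact edgeLike_inf_edgeLike_eq_bot_of_noCore h𝒢 hNC c hne hL₁ hL₂
  rw [← Subgroup.inf_relIndex_right, hbot, Subgroup.relIndex_bot_left]
  exact Nat.card_eq_zero_of_infinite

/-- **F-1699 `EdgeLikeDistinct`, instance form, UNCONDITIONALLY at every countable graph of anabelioids WITHOUT
CORE** (the hypotheses of Thm 3.7 are part of the statement `EdgeLikeDistinctAt 𝒢`): edge-like subgroups of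
distinct edges have infinite mutual index, for every chart.  Extends `edgeLikeDistinctAt_of_isLocallyFinite` to
vertices of infinite valence (every star, every TAME graph, …). [cite: MochizukiSemiAnbd2006, Thm 3.7(iv) p.41] -/
theorem edgeLikeDistinctAt_of_noCore
    (hNC : ∀ S : Set 𝒢.graph.Vertex, S.Nonempty → ∃ w ∈ S,
      {b : 𝒢.graph.Branch | 𝒢.graph.abuts b = some w ∧ ∃ b', b' ≠ b ∧ 𝒢.graph.edgeOf b' = 𝒢.graph.edgeOf b ∧
        ∃ w' ∈ S, 𝒢.graph.abuts b' = some w'}.Finite) : EdgeLikeDistinctAt 𝒢 :=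
  fun h𝒢 c _ _ _ _ hL₁ hL₂ hne => relIndex_edgeLike_eq_zero_of_noCore h𝒢 hNC c hne hL₁ hL₂

end ProfiniteSemiGraph

end Literature.AnabelianGeometry.SemiGraphs
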